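import Mathlib.Tactic
import HarnessLib

/-!
# NE7SliceRepresentativeNL0Budget — THE k-FREE BUDGET OF THE (R1″) END CURRENCY (memo ROAD-G103 §7 (J3), pure real arithmetic): from the letters of `NE7SliceTheoremNL0Curved.slice_theorem_curved_nl0`
# (`K`, `frameC`, `supC0`, `supCurlC0`, `cruxC`, `thetaLoc`, `twoLevelSmall`, the dimension `dd`, `b̂`, `ε₁`, `L`, `nbRad`) and of [B7]'s Prop-4 regime (`C0`, `c2′`, `c3`, the frame-defect slope
# `G = 56(dd·L)² + 16·131072(dd+1)²(dd·L)`) and the two direct-letter lines (`K₁`, `r_K`, `s₁`, `r₁`), ONE constant `E > 0` and the k-free currencies `α₀, τ₀, ê, ĉ, C_δ, C_S, C_b` such that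
# `ε·E ≤ 1` delivers every numeric line of the END (`NE7SliceRepresentativeNL0`): the pattern of `NE7SliceRepresentative.budget` with the B7 α-lines, the orbit radius `M·b₁ = C_b·ε`, the frame
# currency `ω = 4G·C_b·ε` and the direct letters' radius lines added

Cell `pub-balaban`, rung (B)+1 sub-cell t4, lineage `b2b-balaban-t4-ne7-p1`, generation 104 (CRUX PROVER NE7 #1 = OWNER of BINDER row NE7).  Memo `t4/b2b-balaban-t4-ne7-p1-g103/ROAD-G103.md` §7.
WHAT ([folklore]; 0 def, 0 sorry).  `le_mul_of_div_le` (the budget pattern), **`budget_nl0`** (statement displayed).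
HONEST FRAMING (page 1): real-number bookkeeping, no lattice object in sight; nothing of Bałaban's asserted; NOT NE7; spine 0∕9; finite T⁴ rung (B)+1 — NOT infinite volume, NOT mass gap, NOT BetaPertH, NOT Clay
(continuum YM on T⁴ ⇐ BetaPertH ∧ nine spine estimates, 0/9 proved).
-/

set_option autoImplicit false

namespace Summit.QuantumFields.BalabanUV.T4Continuum.NE7SliceRepresentativeNL0Budget

/-- the budget pattern: `0 < r`, `a ∕ r ≤ E`, `ε·E ≤ 1`, `0 ≤ ε` ⟹ `a·ε ≤ r`. [folklore] -/
theorem mul_le_of_div_le {a r E ε : ℝ} (hr : 0 < r) (hE : a / r ≤ E) (hεE : ε * E ≤ 1) (hε : 0 ≤ ε) : a * ε ≤ r := by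
  have h1 : a ≤ r * E := by rw [div_le_iff₀ hr] at hE; linarith
  have h2 : a * ε ≤ r * E * ε := mul_le_mul_of_nonneg_right h1 hε
  nlinarith

set_option maxHeartbeats 400000 in
/-- **THE BUDGET OF THE (R1″) END.**  Inputs (all k-free): `K > 0` (curved sup letter), `fC, sC, sCC ≥ 0` (`frameC`, `supC0`, `supCurlC0`), `crx, thl, tls ≥ 0` (`cruxC`, `thetaLoc`, `twoLevelSmall`),
`dd ≥ 1` (dimension), `b̂ ≥ 0` (near-representative constant), `ε₁ > 0`, `Lr, nb ≥ 0`, B7's `C0r ≥ 0`, `c2r, c3r > 0`, the slope `G ≥ 0`, the direct letters' `K₁ ≥ 0`, `rK > 0`, `s₁ ≥ 0`, `r₁ > 0`.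
Outputs: `E > 0`, `α₀ > 0` with `C0r·(2α₀) ≤ 1∕3`, `8α₀ ≤ c2r`, `3200(dd+1)²(dd+4)·α₀ ≤ 1∕10`; `τ₀ ∈ (0, 1∕4]` with `30000dd·τ₀ ≤ 1`, `X₀·τ₀ ≤ 1∕4` (`X₀ = 3·10⁶(1+16K)(1+dd)³(1+fC)(1+sC+sCC)`); the
currencies `ê, ĉ, C_δ, C_S, C_b` with their defining equations; and `∀ ε ∈ (0, 1∕E]` the displayed lines. [folklore] -/
theorem budget_nl0 {K fC sC sCC crx thl tls dd bh ε₁ Lr nb C0r c2r c3r G K₁ rK s₁ r₁ : ℝ} (hK : 0 < K) (hfC : 0 ≤ fC) (hsC : 0 ≤ sC) (hsCC : 0 ≤ sCC)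
    (hcrx : 0 ≤ crx) (hthl : 0 ≤ thl) (htls : 0 ≤ tls) (hdd : 1 ≤ dd) (hbh : 0 ≤ bh) (hε₁ : 0 < ε₁) (hLr : 0 ≤ Lr) (hnb : 0 ≤ nb)
    (hC0r : 0 ≤ C0r) (hc2r : 0 < c2r) (hc3r : 0 < c3r) (hG : 0 ≤ G) (hK₁ : 0 ≤ K₁) (hrK : 0 < rK) (hs₁ : 0 ≤ s₁) (hr₁ : 0 < r₁) :
    ∃ E : ℝ, 0 < E ∧ ∃ α₀ τ₀ eh ch Cδ CS Cb : ℝ,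
      0 < α₀ ∧ C0r * (2 * α₀) ≤ 1 / 3 ∧ 8 * α₀ ≤ c2r ∧ 4 * (800 * (dd + 1) ^ 2 * (dd + 4)) * α₀ ≤ 1 / 10 ∧
      0 < τ₀ ∧ τ₀ ≤ 1 / 4 ∧ 30000 * dd * τ₀ ≤ 1 ∧ 3000000 * (1 + 16 * K) * (1 + dd) ^ 3 * (1 + fC) * (1 + sC + sCC) * τ₀ ≤ 1 / 4 ∧
      0 < Cδ ∧ 0 < CS ∧ 0 < Cb ∧
      eh = 2 * bh + 2 * sC * ((3 + 12 * dd) * (2 * bh) + 8 * G * bh ^ 2) ∧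
      ch = 2 + 192 * bh ^ 2 + 2 * sCC * ((3 + 12 * dd) * (2 * bh) + 8 * G * bh ^ 2) ∧
      Cδ = eh * (1 + fC + 8 * K * fC + 16 * K * dd) + 2 * K * ch + (8 * K + 1) * (4 * G * bh ^ 2) ∧
      CS = 2 * bh + 24 * dd * Cδ ∧ Cb = 6 * CS + 6 * Cδ ∧
      ∀ ε : ℝ, 0 < ε → ε * E ≤ 1 →
        ε ≤ 1 ∧ ε ≤ ε₁ ∧ 2 * ε ≤ α₀ ∧ 64 * bh * ε ≤ 1 ∧
        14464 * (dd + 1) ^ 2 * (dd + 4) ^ 2 * Lr ^ 2 * (8 / 3) * ε ≤ 1 / 2 ∧ 2 * tls * ε ≤ 1 ∧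
        (4 * dd ^ 2 + 16 * dd * (17 * ((dd + 1) * (dd + 4))) + 4 * dd * (dd - 1)) * ε ≤ 1 / 2 ∧
        (1250 * (nb + Lr) + 8 * (dd * Lr) + 2 * Lr) * (16 * (dd + 1) * (dd + 4) * Lr ^ 2) * ε ≤ 1 / 4 ∧
        crx * ε ≤ 1 / 2 ∧ thl * ε ≤ 1 / 2 ∧
        6 * dd * Cδ * ε ≤ 1 / 10000 ∧ Cδ * ε ≤ τ₀ ∧ CS * ε ≤ 1 / 10000 ∧ CS * ε ≤ τ₀ ∧ ε ≤ τ₀ ∧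
        8 * (131072 * (dd + 1) ^ 2) * (Cb * ε) ≤ 1 / 10 ∧ 8 * (131072 * (dd + 1) ^ 2) * (2 * (bh * ε)) ≤ 1 / 10 ∧ 8 * (131072 * (dd + 1) ^ 2) * (CS * ε) ≤ 1 / 10 ∧
        2 * (Cb * ε) ≤ c3r ∧ 2 * (2 * (bh * ε)) ≤ c3r ∧ 4 * (CS * ε) ≤ c3r ∧
        100 * (dd * Lr * (Cb * ε)) ≤ 1 ∧ 100 * (dd * Lr * (2 * (bh * ε))) ≤ 1 ∧
        16 * (131072 * (dd + 1) ^ 2) * (Cb * ε) ≤ 1 ∧ 16 * (131072 * (dd + 1) ^ 2) * (2 * (bh * ε)) ≤ 1 ∧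
        2048 * dd * (Cb * ε) ≤ 1 ∧ 2048 * dd * (2 * (bh * ε)) ≤ 1 ∧ 2048 * dd * (CS * ε) ≤ 1 ∧
        16 * K₁ * (CS * ε) ≤ rK ∧ s₁ * (8 / 3 * ε) ≤ r₁ ∧
        τ₀ + 4 * G * (Cb * ε) ≤ 1 ∧ 3000000 * (1 + 16 * K) * (1 + dd) ^ 3 * (1 + fC) * (1 + sC + sCC) * (τ₀ + 4 * G * (Cb * ε)) ≤ 1 / 2 := by
  have hdd0 : 0 ≤ dd := by linarith
  -- `X₀` and `τ₀`
  obtain ⟨X₀, hX₀⟩ : ∃ X₀ : ℝ, X₀ = 3000000 * (1 + 16 * K) * (1 + dd) ^ 3 * (1 + fC) * (1 + sC + sCC) := ⟨_, rfl⟩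
  have hX₀0 : 0 ≤ X₀ := by rw [hX₀]; positivity
  obtain ⟨τ₀, hτ₀⟩ : ∃ τ₀ : ℝ, τ₀ = 1 / (30000 * dd + 4 * X₀ + 4) := ⟨_, rfl⟩
  have hden : 0 < 30000 * dd + 4 * X₀ + 4 := by positivity
  have hτ₀0 : 0 < τ₀ := by rw [hτ₀]; positivity
  have hτ₀d : τ₀ * (30000 * dd + 4 * X₀ + 4) = 1 := by rw [hτ₀]; field_simp
  have hτdd : 0 ≤ τ₀ * dd := mul_nonneg hτ₀0.le hdd0
  have hτX : 0 ≤ τ₀ * X₀ := mul_nonneg hτ₀0.le hX₀0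
  have hτ₀1 : τ₀ ≤ 1 / 4 := by linarith only [hτ₀d, hτdd, hτX, hτ₀0]
  have hτ₀s : 30000 * dd * τ₀ ≤ 1 := by linarith only [hτ₀d, hτdd, hτX, hτ₀0]
  have hτ₀C : X₀ * τ₀ ≤ 1 / 4 := by linarith only [hτ₀d, hτdd, hτX, hτ₀0]
  -- `α₀`
  obtain ⟨A, hA⟩ : ∃ A : ℝ, A = 6 * C0r + 8 / c2r + 40 * (4 * (800 * (dd + 1) ^ 2 * (dd + 4))) + 1 := ⟨_, rfl⟩
  have hA0 : 0 < A := by rw [hA]; positivity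
  obtain ⟨α₀, hα₀⟩ : ∃ α₀ : ℝ, α₀ = 1 / A := ⟨_, rfl⟩
  have hα₀0 : 0 < α₀ := by rw [hα₀]; positivity
  have h8c : 0 ≤ 8 / c2r := by positivity
  have hce : 0 ≤ 40 * (4 * (800 * (dd + 1) ^ 2 * (dd + 4))) := by positivity
  -- `t ≤ A ⟹ t·α₀ ≤ 1`
  have hαle : ∀ {t : ℝ}, t ≤ A → t * α₀ ≤ 1 := fun {t} ht => by
    rw [hα₀, mul_one_div]; exact div_le_one_of_le₀ ht hA0.le
  have hα1 : C0r * (2 * α₀) ≤ 1 / 3 := by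
    have h : 6 * C0r * α₀ ≤ 1 := hαle (by rw [hA]; linarith)
    linarith
  have hα2 : 8 * α₀ ≤ c2r := by
    have h1 : 8 / c2r * α₀ ≤ 1 := hαle (by rw [hA]; linarith)
    have h2 : 8 / c2r * α₀ * c2r = 8 * α₀ := by field_simp
    have h3 := mul_le_mul_of_nonneg_right h1 hc2r.le
    rw [h2, one_mul] at h3; exact h3
  have hα3 : 4 * (800 * (dd + 1) ^ 2 * (dd + 4)) * α₀ ≤ 1 / 10 := by
    have h1 : 40 * (4 * (800 * (dd + 1) ^ 2 * (dd + 4))) * α₀ ≤ 1 := hαle (by rw [hA]; linarith)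
    linarith
  -- the currencies
  obtain ⟨eh, heh⟩ : ∃ eh : ℝ, eh = 2 * bh + 2 * sC * ((3 + 12 * dd) * (2 * bh) + 8 * G * bh ^ 2) := ⟨_, rfl⟩
  have heh0 : 0 ≤ eh := by rw [heh]; positivity
  obtain ⟨ch, hch⟩ : ∃ ch : ℝ, ch = 2 + 192 * bh ^ 2 + 2 * sCC * ((3 + 12 * dd) * (2 * bh) + 8 * G * bh ^ 2) := ⟨_, rfl⟩
  have hch2 : 2 ≤ ch := by
    have : 0 ≤ 192 * bh ^ 2 + 2 * sCC * ((3 + 12 * dd) * (2 * bh) + 8 * G * bh ^ 2) := by positivity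
    rw [hch]; linarith
  obtain ⟨Cδ, hCδ⟩ : ∃ Cδ : ℝ, Cδ = eh * (1 + fC + 8 * K * fC + 16 * K * dd) + 2 * K * ch + (8 * K + 1) * (4 * G * bh ^ 2) := ⟨_, rfl⟩
  have hCδK : 4 * K ≤ Cδ := by
    have h1 : 0 ≤ eh * (1 + fC + 8 * K * fC + 16 * K * dd) := by positivity
    have h2 : 2 * K * 2 ≤ 2 * K * ch := mul_le_mul_of_nonneg_left hch2 (by positivity)
    have h3 : 0 ≤ (8 * K + 1) * (4 * G * bh ^ 2) := by positivity
    rw [hCδ]; linarith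
  have hCδ0 : 0 < Cδ := by linarith
  obtain ⟨CS, hCS⟩ : ∃ CS : ℝ, CS = 2 * bh + 24 * dd * Cδ := ⟨_, rfl⟩
  have hCSpos : 0 < CS := by rw [hCS]; positivity
  have hddCδ : 0 ≤ dd * Cδ := mul_nonneg hdd0 hCδ0.le
  have hCSbh : 2 * bh ≤ CS := by rw [hCS]; linarith only [hddCδ]
  obtain ⟨Cb, hCb⟩ : ∃ Cb : ℝ, Cb = 6 * CS + 6 * Cδ := ⟨_, rfl⟩
  have hCbpos : 0 < Cb := by rw [hCb]; positivity
  have hCbCS : CS ≤ Cb := by rw [hCb]; linarith only [hCSpos, hCδ0]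
  have hCbbh : 2 * bh ≤ Cb := hCSbh.trans hCbCS
  -- the class constants
  obtain ⟨cθ, hcθ⟩ : ∃ cθ : ℝ, cθ = 4 * dd ^ 2 + 16 * dd * (17 * ((dd + 1) * (dd + 4))) + 4 * dd * (dd - 1) := ⟨_, rfl⟩
  have hcθ0 : 0 ≤ cθ := by
    have : 0 ≤ dd - 1 := by linarith
    rw [hcθ]; positivity
  obtain ⟨cLS, hcLS⟩ : ∃ cLS : ℝ, cLS = 14464 * (dd + 1) ^ 2 * (dd + 4) ^ 2 * Lr ^ 2 * (8 / 3) := ⟨_, rfl⟩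
  have hcLS0 : 0 ≤ cLS := by rw [hcLS]; positivity
  obtain ⟨Cc, hCc⟩ : ∃ Cc : ℝ, Cc = (1250 * (nb + Lr) + 8 * (dd * Lr) + 2 * Lr) * (16 * (dd + 1) * (dd + 4) * Lr ^ 2) := ⟨_, rfl⟩
  have hCc0 : 0 ≤ Cc := by rw [hCc]; positivity
  obtain ⟨P, hP⟩ : ∃ P : ℝ, P = 8 * (131072 * (dd + 1) ^ 2) := ⟨_, rfl⟩
  have hP0 : 0 ≤ P := by rw [hP]; positivity
  -- group A and group B of the budget
  obtain ⟨EA, hEA⟩ : ∃ EA : ℝ, EA = 1 + 1 / ε₁ + 2 / α₀ + 64 * bh + 2 * cLS + 2 * tls + 2 * cθ + 4 * Cc + 2 * crx + 2 * thl := ⟨_, rfl⟩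
  obtain ⟨EB, hEB⟩ : ∃ EB : ℝ, EB = 10000 * (6 * dd * Cδ) + (Cδ + CS + 1) / τ₀ + 10000 * CS + 10 * (P * Cb) + 4 * Cb / c3r + 100 * (dd * Lr * Cb) + 2048 * dd * Cb
      + 16 * K₁ * CS / rK + s₁ * (8 / 3) / r₁ + 8 * G * Cb + 16 * X₀ * G * Cb := ⟨_, rfl⟩
  have tA1 : 0 ≤ 1 / ε₁ := by positivity
  have tA2 : 0 ≤ 2 / α₀ := by positivity
  have tA3 : 0 ≤ 64 * bh := by positivity
  have tA4 : 0 ≤ 2 * cLS := by positivity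
  have tA5 : 0 ≤ 2 * tls := by positivity
  have tA6 : 0 ≤ 2 * cθ := by positivity
  have tA7 : 0 ≤ 4 * Cc := by positivity
  have tA8 : 0 ≤ 2 * crx := by positivity
  have tA9 : 0 ≤ 2 * thl := by positivity
  have tB1 : 0 ≤ 10000 * (6 * dd * Cδ) := by positivity
  have tB2 : 0 ≤ (Cδ + CS + 1) / τ₀ := by positivity
  have tB3 : 0 ≤ 10000 * CS := by positivity
  have tB4 : 0 ≤ 10 * (P * Cb) := by positivity
  have tB5 : 0 ≤ 4 * Cb / c3r := by positivity
  have tB6 : 0 ≤ 100 * (dd * Lr * Cb) := by positivity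
  have tB7 : 0 ≤ 2048 * dd * Cb := by positivity
  have tB8 : 0 ≤ 16 * K₁ * CS / rK := by positivity
  have tB9 : 0 ≤ s₁ * (8 / 3) / r₁ := by positivity
  have tB10 : 0 ≤ 8 * G * Cb := by positivity
  have tB11 : 0 ≤ 16 * X₀ * G * Cb := by positivity
  have hEA1 : 1 ≤ EA := by rw [hEA]; linarith
  have hEB0 : 0 ≤ EB := by rw [hEB]; linarith
  refine ⟨EA + EB, by linarith, α₀, τ₀, eh, ch, Cδ, CS, Cb, hα₀0, hα1, hα2, hα3, hτ₀0, hτ₀1, hτ₀s, by rw [← hX₀]; exact hτ₀C, hCδ0, hCSpos, hCbpos,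
    heh, hch, hCδ, hCS, hCb, fun ε hε hεE => ?_⟩
  have hε0 : 0 ≤ ε := hε.le
  have hεEA : 0 ≤ ε * EA := mul_nonneg hε0 (by linarith only [hEA1])
  have hεEB : 0 ≤ ε * EB := mul_nonneg hε0 hEB0
  have hεA : ε * EA ≤ 1 := by linarith only [hεE, hεEB]
  have hεB : ε * EB ≤ 1 := by linarith only [hεE, hεEA]
  -- group A
  have l1 : ε ≤ 1 := by nlinarith only [hεA, hEA1, hε0]
  have gA : ∀ {a r : ℝ}, 0 < r → a / r ≤ EA → a * ε ≤ r := fun hr h => mul_le_of_div_le hr h hεA hε0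
  have l2 : ε ≤ ε₁ := by
    have h := gA (a := 1) (r := ε₁) hε₁ (by rw [hEA]; linarith)
    linarith
  have l3 : 2 * ε ≤ α₀ := gA hα₀0 (by rw [hEA]; linarith)
  have l4 : 64 * bh * ε ≤ 1 := gA one_pos (by rw [hEA, div_one]; linarith)
  have l5 : cLS * ε ≤ 1 / 2 := gA (by norm_num) (by rw [hEA]; rw [show cLS / (1 / 2) = 2 * cLS by ring]; linarith)
  have l6 : 2 * tls * ε ≤ 1 := gA one_pos (by rw [hEA, div_one]; linarith)
  have l7 : cθ * ε ≤ 1 / 2 := gA (by norm_num) (by rw [hEA]; rw [show cθ / (1 / 2) = 2 * cθ by ring]; linarith)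
  have l8 : Cc * ε ≤ 1 / 4 := gA (by norm_num) (by rw [hEA]; rw [show Cc / (1 / 4) = 4 * Cc by ring]; linarith)
  have l9 : crx * ε ≤ 1 / 2 := gA (by norm_num) (by rw [hEA]; rw [show crx / (1 / 2) = 2 * crx by ring]; linarith)
  have l10 : thl * ε ≤ 1 / 2 := gA (by norm_num) (by rw [hEA]; rw [show thl / (1 / 2) = 2 * thl by ring]; linarith)
  -- group B
  have gB : ∀ {a r : ℝ}, 0 < r → a / r ≤ EB → a * ε ≤ r := fun hr h => mul_le_of_div_le hr h hεB hε0
  have m1 : 6 * dd * Cδ * ε ≤ 1 / 10000 := gB (by norm_num) (by rw [hEB]; rw [show 6 * dd * Cδ / (1 / 10000) = 10000 * (6 * dd * Cδ) by ring]; linarith)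
  have m2 : (Cδ + CS + 1) * ε ≤ τ₀ := gB hτ₀0 (by rw [hEB]; linarith)
  have m3 : CS * ε ≤ 1 / 10000 := gB (by norm_num) (by rw [hEB]; rw [show CS / (1 / 10000) = 10000 * CS by ring]; linarith)
  have m4 : P * Cb * ε ≤ 1 / 10 := gB (by norm_num) (by rw [hEB]; rw [show P * Cb / (1 / 10) = 10 * (P * Cb) by ring]; linarith)
  have m5 : 4 * Cb * ε ≤ c3r := gB hc3r (by rw [hEB]; linarith)
  have m6 : 100 * (dd * Lr * Cb) * ε ≤ 1 := gB one_pos (by rw [hEB, div_one]; linarith)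
  have m7 : 2048 * dd * Cb * ε ≤ 1 := gB one_pos (by rw [hEB, div_one]; linarith)
  have m8 : 16 * K₁ * CS * ε ≤ rK := gB hrK (by rw [hEB]; linarith)
  have m9 : s₁ * (8 / 3) * ε ≤ r₁ := gB hr₁ (by rw [hEB]; linarith)
  have m10 : 8 * G * Cb * ε ≤ 1 := gB one_pos (by rw [hEB, div_one]; linarith)
  have m11 : 16 * X₀ * G * Cb * ε ≤ 1 := gB one_pos (by rw [hEB, div_one]; linarith)
  -- monotonicity in the radius: `2b̂ ≤ C_S ≤ C_b`
  have q1 : 0 ≤ CS * ε := mul_nonneg hCSpos.le hε0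
  have q2 : 0 ≤ Cδ * ε := mul_nonneg hCδ0.le hε0
  have q3 : 0 ≤ bh * ε := mul_nonneg hbh hε0
  have q4 : 0 ≤ Cb * ε := mul_nonneg hCbpos.le hε0
  have r1 : 2 * (bh * ε) ≤ CS * ε := by have := mul_le_mul_of_nonneg_right hCSbh hε0; linarith only [this]
  have r2 : CS * ε ≤ Cb * ε := mul_le_mul_of_nonneg_right hCbCS hε0
  have r3 : 2 * (bh * ε) ≤ Cb * ε := r1.trans r2
  have hPCb : P * (Cb * ε) ≤ 1 / 10 := by linarith only [m4]
  have hPCS : P * (CS * ε) ≤ 1 / 10 := (mul_le_mul_of_nonneg_left r2 hP0).trans hPCb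
  have hPbh : P * (2 * (bh * ε)) ≤ 1 / 10 := (mul_le_mul_of_nonneg_left r3 hP0).trans hPCb
  have hdL : 0 ≤ dd * Lr := by positivity
  have n1 := mul_le_mul_of_nonneg_left r3 hdL
  have n2 := mul_le_mul_of_nonneg_left r3 hdd0
  have n3 := mul_le_mul_of_nonneg_left r2 hdd0
  have hP2 : 16 * (131072 * (dd + 1) ^ 2) = 2 * P := by rw [hP]; ring
  refine ⟨l1, l2, l3, l4, by rw [← hcLS]; exact l5, l6, by rw [← hcθ]; exact l7, by rw [← hCc]; exact l8, l9, l10, m1, ?_, m3, ?_, ?_,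
    by rw [← hP]; exact hPCb, by rw [← hP]; exact hPbh, by rw [← hP]; exact hPCS, by linarith only [m5, q4], by linarith only [m5, r3, q4], by linarith only [m5, r2],
    by linarith only [m6], by linarith only [m6, n1],
    ?_, ?_, by linarith only [m7], by linarith only [m7, n2], by linarith only [m7, n3],
    by linarith only [m8], by linarith only [m9], ?_, ?_⟩
  · linarith only [m2, q1, hε0]
  · linarith only [m2, q2, hε0]
  · linarith only [m2, q1, q2]
  · rw [hP2]; linarith only [hPCb]
  · rw [hP2]; linarith only [hPbh]
  · linarith only [hτ₀1, m10]
  · rw [← hX₀]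
    linarith only [hτ₀C, m11, hX₀0]

end Summit.QuantumFields.BalabanUV.T4Continuum.NE7SliceRepresentativeNL0Budget
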